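import Summits.ABC.ABC.Theses.DefiniteXi
import Summits.ABC.ABC.Theorems.IsogenyGlueCongruenceMazurKenkuBoundLevelThirtyTwo
import Literature.NumberTheory.EllipticCurves.PastenHeightBoundsLemma68LocalProofs
import Literature.NumberTheory.EllipticCurves.OpenImageMazurAssemblyProofs
import Literature.NumberTheory.EllipticCurves.OpenImageMazurInertiaProofs
import Literature.NumberTheory.EllipticCurves.OpenImageMazurInertiaThreeProofs
import Literature.NumberTheory.EllipticCurves.OpenImageMazurCharacterProofs
import Literature.NumberTheory.EllipticCurves.CyclicIsogenyCharacterFrobeniusProofs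
import Literature.NumberTheory.EllipticCurves.RationalIsogenyFrobeniusCriterionPrimePower
import Literature.NumberTheory.EllipticCurves.RationalIsogenyDegreesProofs
import Literature.NumberTheory.EllipticCurves.PastenValuationProductThm75MultiplicityProofs
import Literature.NumberTheory.EllipticCurves.SzpiroFreyCurveProofs
import Literature.NumberTheory.DiophantineGeometry.LocalReductionProofs
import HarnessLib

/-!
# Stub-ideation k=2 (gen 9, FAMILY 2 — RESHAPE) for `stub_pastenLemma68` — crux `DefiniteRTControlPrime`

Companion to `STUB-IDEAS-stub_pastenLemma68-2.md` (gen 9).  Scratch check that the helper STATEMENTS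
elaborate; every `sorry` is a HELPER BODY (one stub-prover cycle each); the `sorry`-free items are PROVED.

* §0 Verbatim stub `PastenShimura2024_lemma_6_8` = Mazur–Kenku-complete (tree
  `prime_degree_le_163_of_PastenShimura2024_lemma_6_8`); closer `PastenShimura2024_lemma_6_8_of_mazurKenku'`
  from the open item `MazurKenkuRadius` (stmt-ABC-15193); its `163`-FREE content
  `exists_ordMinimalDiscriminant_mul_eq_mul_of_isCyclic` is LANDED, so the stub with `163 ↦ R` is a
  two-line corollary (`lemma68_of_isCyclic_degree_le`, PROVED) — the stub's own share of ANY reshape is 0 cycles.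
* §1–§6 Gen 9 = CONSOLIDATION of the Mazur-free "uniform-12 half-level" radius line (k2-163 g3–g7) on the
  landed Mazur-1978 library, with gen 8's detour (normal form N0–N2, regime split T3R/H5, exact dichotomy)
  DELETED: the places `v ≠ ℓ` are handled by ONE uniform lemma `unitsMap_cyclicCharacter_pow_twelve_eq_one`
  (PROVED here from the two landed `Mazur1978.pow_twelve_smul_eq_of_mem_inertia_of_valuation_j_le_one[_of_three]`
  and the twist lemma T2), with NO reduction-type, minimality or normalisation hypothesis; semistability is
  needed ONLY at `v = ℓ` (LOCℓ), where the Frey curve has it for free (`isSemistableAt_freyCurve_holds`).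
  Output C0² (g7 verbatim) ⇒ rooted leaf `FreyIsogenyRadiusSubpoly` (k2-g5 verbatim) ⇒ G5 consumer
  `definiteRTControlPrime_of_freyIsogenyRadiusSubpoly (hT) (hR) : DefiniteRTControlPrime` (PROVED in
  `StubIdeasK2G5PastenLemma68.lean`, crux workfile) — `stub_pastenLemma68` AND `stub_pasten163` leave the
  trust base, which becomes `{takahashi2001_thm_2_3_of_coprime}`.
-/

set_option linter.dupNamespace false

namespace Summit.ABC.ABC.Cruxes.DefiniteRTControlPrime.StubIdeas2G9

open Literature.NumberTheory.EllipticCurves Literature.NumberTheory.EllipticCurves.ModularForms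
open Literature.NumberTheory.GaloisRepresentations Literature.NumberTheory.DiophantineGeometry
open Summit.ABC.ABC.Theses.DefiniteXi
open WeierstrassCurve IsDedekindDomain NumberField Field
open scoped NumberField

/-! ## §0 The verbatim stub: closer, depth, and its `163`-free content (all by name) -/

example : mazurKenku_exists_cyclic_isogeny → PastenShimura2024_lemma_6_8 :=
  PastenShimura2024_lemma_6_8_of_mazurKenku'

/-- Depth certificate (tree): the verbatim stub bounds prime isogeny degrees at a multiplicative place,
i.e. it contains Mazur 1978 Thm 1 for non-integral `j` — no Mazur-free proof of the stub AS TYPED. -/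
example (h68 : PastenShimura2024_lemma_6_8) {W W' : WeierstrassCurve ℚ} [W.IsElliptic] [W'.IsElliptic]
    (φ : Isogeny W W') {ℓ : ℕ} (hℓ : ℓ.Prime) (hdeg : φ.degree = ℓ) (v : HeightOneSpectrum ℤ)
    (hv : W.HasMultiplicativeReductionAt v) : ℓ ≤ 163 :=
  prime_degree_le_163_of_PastenShimura2024_lemma_6_8 h68 φ hℓ hdeg v hv

/-- **R68(R) (PROVED; the stub's share of every reshape).**  Lemma 6.8 with `163` replaced by the degree
bound `R` of ONE cyclic isogeny `W → W'`: two lines from the landed free-constant transport lemma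
`exists_ordMinimalDiscriminant_mul_eq_mul_of_isCyclic` (Pasten–Shimura §6.4). -/
theorem lemma68_of_isCyclic_degree_le {R : ℕ} {W W' : WeierstrassCurve ℚ} [W.IsElliptic]
    [W'.IsElliptic] (φ : Isogeny W W') (hφ : φ.IsCyclic) (hR : φ.degree ≤ R)
    (v : HeightOneSpectrum ℤ) (hv : W.HasMultiplicativeReductionAt v) :
    ∃ m n : ℕ, 0 < m ∧ m ≤ R ∧ 0 < n ∧ n ≤ R ∧
      W.ordMinimalDiscriminant v * n = W'.ordMinimalDiscriminant v * m := by
  have hv' : W'.HasMultiplicativeReductionAt v := hasMultiplicativeReductionAt_of_isIsogenous ⟨φ⟩ v hv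
  obtain ⟨a, b, ha, hb, hab, h⟩ :=
    exists_ordMinimalDiscriminant_mul_eq_mul_of_isCyclic φ.degree φ hφ rfl v hv hv'
  have habn : a * b ≤ φ.degree := Nat.le_of_dvd φ.degree_pos hab
  refine ⟨a, b, ha, ?_, hb, ?_, h⟩
  · have : a ≤ a * b := Nat.le_mul_of_pos_right a hb
    omega
  · have : b ≤ a * b := Nat.le_mul_of_pos_left b ha
    omega

/-- The cyclic factor (tree): isogenous curves are joined by a CYCLIC isogeny. -/
example {W W' : WeierstrassCurve ℚ} [W.IsElliptic] (h : W.IsIsogenous W') :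
    ∃ ψ : Isogeny W W', ψ.IsCyclic :=
  h.exists_isCyclic

/-! ## §1 Half level, `n₁₂`, the typed output C0² and the rooted leaf (verbatim from k2-163 g3–g7 / k2-g5) -/

/-- `⌈k/2⌉`. -/
def halfCeil (k : ℕ) : ℕ := (k + 1) / 2

theorem halfCeil_le (k : ℕ) : halfCeil k ≤ k := by unfold halfCeil; omega

theorem le_two_mul_halfCeil (k : ℕ) : k ≤ 2 * halfCeil k := by unfold halfCeil; omega

theorem pow_halfCeil_dvd (ℓ k : ℕ) : ℓ ^ halfCeil k ∣ ℓ ^ k := pow_dvd_pow ℓ (halfCeil_le k)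

/-- `n₁₂(p) = p¹² + 1 − s₁₂(a_p, p) = #Ẽ(𝔽_{p¹²})`. -/
noncomputable def frobNorm (W : WeierstrassCurve ℚ) [W.IsGloballyMinimal] (p : ℕ) : ℤ :=
  (p : ℤ) ^ 12 + 1 - Mazur1978.frobTracePow (W.frobeniusTrace p) p 12

/-- **C0² (g7 verbatim; the typed Mazur–Kenku-free output of the line).** -/
def CyclicDegreeDvdFrobNormSq : Prop :=
  ∀ (W₁ W₂ : WeierstrassCurve ℚ) [W₁.IsElliptic] [W₂.IsElliptic] [W₁.IsGloballyMinimal],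
    (∀ v : HeightOneSpectrum (𝓞 ℚ), (2 : 𝓞 ℚ) ∉ v.asIdeal → W₁.IsSemistableAt v) →
    ∀ (φ : Isogeny W₁ W₂), φ.IsCyclic →
    ∀ (p₀ p₁ : ℕ) [Fact p₀.Prime] [Fact p₁.Prime], p₀ ≠ 2 → p₁ ≠ 2 → p₀ ≠ p₁ →
      W₁.HasGoodReductionAtPrime p₀ → W₁.HasGoodReductionAtPrime p₁ →
      φ.degree ∣ 16 * ((frobNorm W₁ p₀ * frobNorm W₁ p₁).natAbs) ^ 2

/-- **L1ε (k2-g5 verbatim).**  Sub-polynomial ROOTED radius of the Frey class; consumer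
`definiteRTControlPrime_of_freyIsogenyRadiusSubpoly (hT : takahashi2001_thm_2_3_of_coprime) (hR)` PROVED
in `StubIdeasK2G5PastenLemma68.lean`. -/
def FreyIsogenyRadiusSubpoly : Prop :=
  ∀ ε : ℝ, 0 < ε → ∃ R : ℝ, ∀ (a b : ℤ), IsCoprime a b → a * b * (a + b) ≠ 0 →
    ∀ q : ℕ, q.Prime → q ≠ 2 → q ∣ (freyCurve a b).conductorNorm ℤ →
    ∀ (W' : WeierstrassCurve ℚ) [W'.IsElliptic], (freyCurve a b).IsIsogenous W' →
      ∃ φ : Isogeny (freyCurve a b) W',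
        (φ.degree : ℝ) ≤ R * (((freyCurve a b).conductorNorm ℤ : ℕ) : ℝ) ^ ε

/-! ## §2 NEW (gen 9): the places `v ≠ ℓ`, UNIFORMLY — no reduction type, no minimality, no normal form -/

/-- **T1⁺ (PROVED; g7's T1 with the `v ∤ 3` restriction removed).**  `j` integral at a place `v ∤ m`
⇒ `r(τ)¹² = 1` on inertia at `v`, at FULL level `m`: through `K(E[3])` if `v ∤ 3`
(`Mazur1978.pow_twelve_smul_eq_of_mem_inertia_of_valuation_j_le_one_of_three`), through `K(E[4])` if
`v ∣ 3` (then `v ∤ 2`; `Mazur1978.pow_twelve_smul_eq_of_mem_inertia_of_valuation_j_le_one`). -/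
theorem cyclicCharacter_pow_twelve_eq_one_of_valuation_j_le_one (W : WeierstrassCurve ℚ)
    [W.IsElliptic] {m : ℕ} [NeZero m] {P : geomPoints W} (hP : addOrderOf P = m)
    {r : absoluteGaloisGroup ℚ →* (ZMod m)ˣ}
    (hr : ∀ σ : absoluteGaloisGroup ℚ, σ • P = ((r σ : (ZMod m)ˣ) : ZMod m).val • P)
    {v : HeightOneSpectrum (𝓞 ℚ)} (hmv : (m : 𝓞 ℚ) ∉ v.asIdeal) (hj : v.valuation ℚ W.j ≤ 1)
    {𝔓 : Ideal (absIntegers (𝓞 ℚ) ℚ)} (h𝔓 : 𝔓 ∈ v.primesAbove)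
    {τ : absoluteGaloisGroup ℚ} (hτ : τ ∈ 𝔓.inertia (absoluteGaloisGroup ℚ)) :
    r τ ^ 12 = 1 := by
  have hmP : m • P = 0 := by rw [← hP]; exact addOrderOf_nsmul_eq_zero P
  have h12 : τ ^ 12 • P = P := by
    by_cases h3 : (3 : 𝓞 ℚ) ∈ v.asIdeal
    · have h2 : (2 : 𝓞 ℚ) ∉ v.asIdeal := by
        intro h2
        have h1 : (1 : 𝓞 ℚ) ∈ v.asIdeal := by
          have h := v.asIdeal.sub_mem h3 h2
          norm_num at h
          exact h
        exact v.isPrime.ne_top ((Ideal.eq_top_iff_one _).mpr h1)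
      exact Mazur1978.pow_twelve_smul_eq_of_mem_inertia_of_valuation_j_le_one W h2 hj h𝔓 hτ hmv hmP
    · exact Mazur1978.pow_twelve_smul_eq_of_mem_inertia_of_valuation_j_le_one_of_three W h3 hj h𝔓 hτ
        hmv hmP
  have h' : ((r (τ ^ 12) : (ZMod m)ˣ) : ZMod m).val • P = P := by rw [← hr]; exact h12
  have h1 : ((r (τ ^ 12) : (ZMod m)ˣ) : ZMod m) = 1 :=
    Mazur1978.eq_one_of_val_smul_eq_of_addOrderOf W hP h'
  rw [map_pow] at h1
  exact Units.val_eq_one.mp h1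

/-- **T2 (S–M; g7 verbatim).**  `j` NON-integral at a place `v ∤ ℓ` ⇒ `r̄(τ)² = 1` on inertia at `v`
(`r̄ = r mod ℓ^⌈k/2⌉`): a quadratic twist `W^{(d)}` is MULTIPLICATIVE at `v`
(`exists_hasMultiplicativeReductionAt_quadraticTwist_of_one_lt_valuation_j`), the signed transport
`exists_addEquiv_geomPoints_quadraticTwist_signed` carries `ℤP` to a stable line with character `r·ε_d`,
`ε_d² = 1`, and on the twist inertia is unipotent MODULO `ℓ^⌈k/2⌉`
(`smul_smul_sub_eq_of_mem_inertia_geomPoints`: `((rε_d)(τ) − 1)²·P = 0`, then g7's U1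
`pow_halfCeil_dvd_of_sq_smul_eq_zero`).  If `W` is itself multiplicative at `v`, `d = 1` (g7 U2).
Prime-level pattern: `Mazur1978.isogenyCharacter_sq_eq_one_of_one_lt_valuation_j`.  Sharp: `11a3`
(`(ℤ/9)²` at `v = 11`). -/
theorem unitsMap_cyclicCharacter_sq_eq_one_of_one_lt_valuation_j (W : WeierstrassCurve ℚ)
    [W.IsElliptic] {v : HeightOneSpectrum (𝓞 ℚ)} (hj : 1 < v.valuation ℚ W.j)
    {ℓ k : ℕ} [Fact ℓ.Prime] (hℓv : (ℓ : 𝓞 ℚ) ∉ v.asIdeal) (hk : 1 ≤ k)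
    {P : geomPoints W} (hP : addOrderOf P = ℓ ^ k)
    {r : absoluteGaloisGroup ℚ →* (ZMod (ℓ ^ k))ˣ}
    (hr : ∀ σ : absoluteGaloisGroup ℚ, σ • P = ((r σ : (ZMod (ℓ ^ k))ˣ) : ZMod (ℓ ^ k)).val • P)
    {𝔓 : Ideal (absIntegers (𝓞 ℚ) ℚ)} (h𝔓 : 𝔓 ∈ v.primesAbove)
    {τ : absoluteGaloisGroup ℚ} (hτ : τ ∈ 𝔓.inertia (absoluteGaloisGroup ℚ)) :
    ZMod.unitsMap (pow_halfCeil_dvd ℓ k) (r τ) ^ 2 = 1 := by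
  sorry

/-- **LOC (PROVED from T1⁺ + T2; THE gen-9 lemma).**  At EVERY place `v ∤ ℓ`, for EVERY model and
EVERY reduction type, the half-level character of a stable cyclic line of order `ℓᵏ` satisfies
`r̄(τ)¹² = 1` on inertia: `v(j) ≥ 0` ⇒ T1⁺ (full level), `v(j) < 0` ⇒ T2.  No semistability, no
`IsGloballyMinimal`, no normal form, no regime split. -/
theorem unitsMap_cyclicCharacter_pow_twelve_eq_one (W : WeierstrassCurve ℚ) [W.IsElliptic]
    {ℓ k : ℕ} [Fact ℓ.Prime] (hk : 1 ≤ k) {P : geomPoints W} (hP : addOrderOf P = ℓ ^ k)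
    {r : absoluteGaloisGroup ℚ →* (ZMod (ℓ ^ k))ˣ}
    (hr : ∀ σ : absoluteGaloisGroup ℚ, σ • P = ((r σ : (ZMod (ℓ ^ k))ˣ) : ZMod (ℓ ^ k)).val • P)
    {v : HeightOneSpectrum (𝓞 ℚ)} (hℓv : (ℓ : 𝓞 ℚ) ∉ v.asIdeal)
    {𝔓 : Ideal (absIntegers (𝓞 ℚ) ℚ)} (h𝔓 : 𝔓 ∈ v.primesAbove)
    {τ : absoluteGaloisGroup ℚ} (hτ : τ ∈ 𝔓.inertia (absoluteGaloisGroup ℚ)) :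
    ZMod.unitsMap (pow_halfCeil_dvd ℓ k) (r τ) ^ 12 = 1 := by
  haveI : NeZero (ℓ ^ k) := ⟨pow_ne_zero _ (Fact.out : ℓ.Prime).ne_zero⟩
  rcases le_or_gt (v.valuation ℚ W.j) 1 with hj | hj
  · have hmv : ((ℓ ^ k : ℕ) : 𝓞 ℚ) ∉ v.asIdeal := by
      rw [Nat.cast_pow]
      exact fun h => hℓv (v.isPrime.mem_of_pow_mem k h)
    have h12 := cyclicCharacter_pow_twelve_eq_one_of_valuation_j_le_one W hP hr hmv hj h𝔓 hτ
    rw [← map_pow, h12, map_one]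
  · have h2 := unitsMap_cyclicCharacter_sq_eq_one_of_one_lt_valuation_j W hj hℓv hk hP hr h𝔓 hτ
    calc ZMod.unitsMap (pow_halfCeil_dvd ℓ k) (r τ) ^ 12
        = (ZMod.unitsMap (pow_halfCeil_dvd ℓ k) (r τ) ^ 2) ^ 6 := by rw [← pow_mul]
      _ = 1 := by rw [h2, one_pow]

/-! ## §3 The place `v = ℓ` (semistable there): EXACT dichotomy on inertia (g7 LOCℓ, sub-helpers there) -/

/-- **LOCℓ (S assembly; g7 verbatim).**  `W` globally minimal, semistable at `v ∣ ℓ`, `ℓ` odd, `k ≥ 1`: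
the character of a stable cyclic line of order `ℓᵏ` is EXACTLY `1` or EXACTLY `χ_{ℓᵏ}` on `I_𝔓`, `𝔓 ∣ ℓ`.
Sub-helpers with signatures in `Lines/StubIdeasK2g7_pasten163.lean`: D1 `filtration_dichotomy` (PROVED),
D2 `exists_ordinaryFiltration` (transport of the landed
`ordinaryReduction_inertia_smul_of_mem_kernelReduction_holds` /
`ordinaryReduction_exists_unramified_character_mod_kernelReduction_holds`), D3′
`exists_multiplicativeFiltration` (landed `TateCurve.exists_twistedTateUniformisation_localKernelOfReduction`
+ `TateCurve.toAlgEquiv_eq_of_mem_inertia_of_sq_eq_gamma`), SS `not_dvd_frobeniusTrace_of_stableLine`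
(supersingular branch of `Mazur1978.modEq_zero_or_one_of_hasGoodReductionAtPrime` on `ℓ^{k−1}P`). -/
theorem cyclicCharacter_eq_one_or_eq_cyclotomic_at_ell (W : WeierstrassCurve ℚ) [W.IsElliptic]
    [W.IsGloballyMinimal] (ℓ k : ℕ) [Fact ℓ.Prime] (hℓ2 : ℓ ≠ 2) (hk : 1 ≤ k)
    {v : HeightOneSpectrum (𝓞 ℚ)} (hℓv : (ℓ : 𝓞 ℚ) ∈ v.asIdeal) (hss : W.IsSemistableAt v)
    {P : geomPoints W} (hP : addOrderOf P = ℓ ^ k)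
    {r : absoluteGaloisGroup ℚ →* (ZMod (ℓ ^ k))ˣ}
    (hr : ∀ σ : absoluteGaloisGroup ℚ, σ • P = ((r σ : (ZMod (ℓ ^ k))ˣ) : ZMod (ℓ ^ k)).val • P)
    {𝔓 : Ideal (absIntegers (𝓞 ℚ) ℚ)} (h𝔓 : 𝔓 ∈ v.primesAbove) :
    (∀ τ ∈ 𝔓.inertia (absoluteGaloisGroup ℚ), r τ = 1) ∨
      (∀ τ ∈ 𝔓.inertia (absoluteGaloisGroup ℚ), r τ = modNCyclotomicCharacter ℚ (ℓ ^ k) τ) := by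
  sorry

/-! ## §4 GLOB⁻ — Minkowski, with semistability assumed ONLY above `ℓ` -/

/-- OPEN (PROVED, g5/g7 verbatim): the character of a stable cyclic line has open kernel. -/
theorem isOpen_ker_of_smul_eq_of_addOrderOf (W : WeierstrassCurve ℚ) [W.IsElliptic] {m : ℕ}
    [NeZero m] {P : geomPoints W} (hP : addOrderOf P = m)
    {r : absoluteGaloisGroup ℚ →* (ZMod m)ˣ}
    (hr : ∀ σ : absoluteGaloisGroup ℚ, σ • P = ((r σ : (ZMod m)ˣ) : ZMod m).val • P) :
    IsOpen ((r.ker : Subgroup (absoluteGaloisGroup ℚ)) : Set (absoluteGaloisGroup ℚ)) := by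
  refine Subgroup.isOpen_mono (H₁ := MulAction.stabilizer (absoluteGaloisGroup ℚ) P) ?_
    (isOpen_stabilizer_point_holds W P)
  intro σ hσ
  rw [MulAction.mem_stabilizer_iff] at hσ
  rw [MonoidHom.mem_ker]
  have hfix : ((r σ : (ZMod m)ˣ) : ZMod m).val • P = P := by rw [← hr σ]; exact hσ
  exact Units.val_eq_one.mp (Mazur1978.eq_one_of_val_smul_eq_of_addOrderOf W hP hfix)

/-- Minkowski (tree, by name): a character with open kernel trivial on every inertia group is trivial. -/
example {M : Type*} [CommGroup M] (ψ : absoluteGaloisGroup ℚ →* M)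
    (hker : IsOpen ((ψ.ker : Subgroup (absoluteGaloisGroup ℚ)) : Set (absoluteGaloisGroup ℚ)))
    (h : ∀ (v : HeightOneSpectrum (𝓞 ℚ)), ∀ 𝔓 ∈ v.primesAbove,
      ∀ τ ∈ 𝔓.inertia (absoluteGaloisGroup ℚ), ψ τ = 1) :
    ψ = 1 :=
  Mazur1978.monoidHom_eq_one_of_forall_inertia ψ hker h

/-- **GLOB⁻ (S; g7 GLOB with the hypothesis cut down to the places above `ℓ`).**  `W` globally minimal,
semistable above `ℓ`, `ℓ` odd, `k ≥ 1`, `ℤP` stable of order `ℓᵏ` with character `r`; `r̄ := r mod ℓ^⌈k/2⌉`,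
`χ̄ := χ_{ℓ^⌈k/2⌉}`.  Then `r̄¹² = 1` OR `r̄¹² = χ̄¹²` on `Γ_ℚ`.  LOCℓ picks the branch (`ψ := r̄¹²` resp.
`(r̄·χ̄⁻¹)¹²`, `Mazur1978.unitsMap_modNCyclotomicCharacter`); `ψ` dies on inertia above `ℓ` by construction
and above every `v ≠ ℓ` by LOC (+ `modNCyclotomicCharacter_eq_one_of_mem_inertia` off `ℓ`); `ker ψ` is open
(OPEN); Minkowski. -/
theorem unitsMap_cyclicCharacter_pow_twelve_dichotomy (W : WeierstrassCurve ℚ) [W.IsElliptic]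
    [W.IsGloballyMinimal] (ℓ k : ℕ) [Fact ℓ.Prime] (hℓ2 : ℓ ≠ 2) (hk : 1 ≤ k)
    (hss : ∀ v : HeightOneSpectrum (𝓞 ℚ), (ℓ : 𝓞 ℚ) ∈ v.asIdeal → W.IsSemistableAt v)
    {P : geomPoints W} (hP : addOrderOf P = ℓ ^ k)
    {r : absoluteGaloisGroup ℚ →* (ZMod (ℓ ^ k))ˣ}
    (hr : ∀ σ : absoluteGaloisGroup ℚ, σ • P = ((r σ : (ZMod (ℓ ^ k))ˣ) : ZMod (ℓ ^ k)).val • P) :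
    (∀ σ : absoluteGaloisGroup ℚ, ZMod.unitsMap (pow_halfCeil_dvd ℓ k) (r σ) ^ 12 = 1) ∨
      (∀ σ : absoluteGaloisGroup ℚ, ZMod.unitsMap (pow_halfCeil_dvd ℓ k) (r σ) ^ 12 =
        modNCyclotomicCharacter ℚ (ℓ ^ halfCeil k) σ ^ 12) := by
  sorry

/-! ## §5 The Frobenius congruence at one good prime, and the counting end -/

/-- A1 (PROVED, g4–g7 verbatim): a root `t` of `X² − aX + p` in `ℤ/n` (`p` a unit) with `t¹² = 1` OR
`t¹² = p¹²` forces `n ∣ p¹² + 1 − s₁₂(a,p)`. -/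
theorem natCast_dvd_frobNorm_of_pow_twelve {n p : ℕ} [NeZero n] (a : ℤ) (hp : IsUnit (p : ZMod n))
    {t : ZMod n} (hroot : t ^ 2 - (a : ZMod n) * t + (p : ZMod n) = 0)
    (ht : t ^ 12 = 1 ∨ t ^ 12 = (p : ZMod n) ^ 12) :
    (n : ℤ) ∣ (p : ℤ) ^ 12 + 1 - Mazur1978.frobTracePow a p 12 := by
  have hprod' : t * ((a : ZMod n) - t) = (p : ZMod n) := by
    linear_combination (-1 : ZMod n) * hroot
  have hsum : t + ((a : ZMod n) - t) = ((a : ℤ) : ZMod n) := by ring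
  have hprod : t * ((a : ZMod n) - t) = (((p : ℕ) : ℤ) : ZMod n) := by
    rw [hprod', Int.cast_natCast]
  have hspec := Mazur1978.frobTracePow_spec hsum hprod 12
  have h12 : ((a : ZMod n) - t) ^ 12 * t ^ 12 = (p : ZMod n) ^ 12 := by
    rw [← mul_pow, mul_comm, hprod']
  rw [← ZMod.intCast_zmod_eq_zero_iff_dvd]
  push_cast
  rw [← hspec]
  rcases ht with h1 | h2
  · rw [h1, mul_one] at h12
    rw [h1, h12]; ring
  · rw [h2] at h12
    have h3 : ((a : ZMod n) - t) ^ 12 = 1 :=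
      (hp.pow 12).mul_right_cancel (h12.trans (one_mul _).symm)
    rw [h2, h3]; ring

/-- The Frobenius congruence at prime-power level (tree, by name). -/
example (W : WeierstrassCurve ℚ) [W.IsElliptic] [W.IsGloballyMinimal] (ℓ k p : ℕ) [Fact ℓ.Prime]
    [Fact p.Prime] (hpℓ : p ≠ ℓ) (hgood : W.HasGoodReductionAtPrime p) {P : geomPoints W}
    (hP : addOrderOf P = ℓ ^ k) {r : absoluteGaloisGroup ℚ →* (ZMod (ℓ ^ k))ˣ}
    (hr : ∀ σ : absoluteGaloisGroup ℚ, σ • P = ((r σ : (ZMod (ℓ ^ k))ˣ) : ZMod (ℓ ^ k)).val • P)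
    {v : HeightOneSpectrum (𝓞 ℚ)} (hv : (p : 𝓞 ℚ) ∈ v.asIdeal)
    {𝔓 : Ideal (absIntegers (𝓞 ℚ) ℚ)} (h𝔓 : 𝔓 ∈ v.primesAbove)
    {φ : absoluteGaloisGroup ℚ} (hφ : IsArithFrobAt (𝓞 ℚ) φ 𝔓) :
    ((r φ : (ZMod (ℓ ^ k))ˣ) : ZMod (ℓ ^ k)) ^ 2
      - (W.frobeniusTrace p : ZMod (ℓ ^ k)) * ((r φ : (ZMod (ℓ ^ k))ˣ) : ZMod (ℓ ^ k))
        + (p : ZMod (ℓ ^ k)) = 0 :=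
  Mazur1978.cyclicCharacter_sq_sub_frobeniusTrace_mul_add_eq_zero W ℓ k p hpℓ hgood hP hr hv h𝔓 hφ

/-- **H5⁻ (S; g7 H5 with semistability only above `ℓ`).**  `ℓ^⌈k/2⌉ ∣ n₁₂(p)` at a good `p ∉ {2, ℓ}`:
character `r` (`exists_cyclicCharacter_of_addOrderOf`), GLOB⁻, an arithmetic Frobenius `φ` over `p`
(`exists_isArithFrobAt_of_mem_primesAbove_holds`), the congruence above cast along
`ZMod.castHom : ZMod (ℓᵏ) → ZMod (ℓ^⌈k/2⌉)`, `χ̄(φ) = p` (`modNCyclotomicCharacter_eq_residueCard_of_isArithFrobAt`),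
so `t := r̄(φ)` has `t¹² = 1` or `t¹² = p¹²`, and A1 (`p` a unit mod `ℓ`). -/
theorem pow_halfCeil_dvd_frobNorm_of_stableLine (W₁ : WeierstrassCurve ℚ) [W₁.IsElliptic]
    [W₁.IsGloballyMinimal] (ℓ k : ℕ) [Fact ℓ.Prime] (hℓ2 : ℓ ≠ 2)
    (hss : ∀ v : HeightOneSpectrum (𝓞 ℚ), (ℓ : 𝓞 ℚ) ∈ v.asIdeal → W₁.IsSemistableAt v)
    {P : geomPoints W₁} (hP : addOrderOf P = ℓ ^ k)
    (hst : ∀ σ : absoluteGaloisGroup ℚ, σ • P ∈ AddSubgroup.zmultiples P)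
    (p : ℕ) [Fact p.Prime] (hp2 : p ≠ 2) (hpℓ : p ≠ ℓ) (hgood : W₁.HasGoodReductionAtPrime p) :
    (ℓ : ℤ) ^ halfCeil k ∣ frobNorm W₁ p := by
  sorry

/-- G0 (XS; pattern = tree `j_ne_of_isogeny_cyclic_primePow_degree_of_certificate`, lines 90ff of
`RationalIsogenyFrobeniusCriterionPrimePower.lean`): the `ℓ`-primary part of a cyclic stable kernel is a
stable cyclic line of order `ℓ^{v_ℓ(deg)}` (`exists_isCyclic_degree_eq_of_dvd`,
`IsAddCyclic.exists_ofOrder_eq_natCard` on `ψ.toAddMonoidHom.ker`). -/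
theorem exists_stableLine_of_isCyclic {W₁ W₂ : WeierstrassCurve ℚ} [W₁.IsElliptic] [W₂.IsElliptic]
    (φ : Isogeny W₁ W₂) (hφ : φ.IsCyclic) (ℓ k : ℕ) [Fact ℓ.Prime] (hdiv : ℓ ^ k ∣ φ.degree) :
    ∃ P : geomPoints W₁, addOrderOf P = ℓ ^ k ∧
      ∀ σ : absoluteGaloisGroup ℚ, σ • P ∈ AddSubgroup.zmultiples P := by
  sorry

/-- C1 (PROVED, g3 verbatim): half exponents at every prime give `d ∣ n²`. -/
theorem dvd_sq_of_forall_pow_halfCeil_dvd {d n : ℕ} (hd : 0 < d) (hn : 0 < n)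
    (h : ∀ ℓ : ℕ, ℓ.Prime → ℓ ∣ d → ℓ ^ halfCeil (d.factorization ℓ) ∣ n) : d ∣ n ^ 2 := by
  rw [← Nat.factorization_le_iff_dvd hd.ne' (pow_pos hn 2).ne', Nat.factorization_pow]
  refine Finsupp.le_def.mpr fun ℓ => ?_
  rw [Finsupp.smul_apply, smul_eq_mul]
  by_cases hℓ : ℓ.Prime
  · by_cases hℓd : ℓ ∣ d
    · have h2 : halfCeil (d.factorization ℓ) ≤ n.factorization ℓ :=
        (hℓ.pow_dvd_iff_le_factorization hn.ne').mp (h ℓ hℓ hℓd)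
      have h3 := le_two_mul_halfCeil (d.factorization ℓ)
      omega
    · rw [Nat.factorization_eq_zero_of_not_dvd hℓd]; exact Nat.zero_le _
  · rw [Nat.factorization_eq_zero_of_not_prime d hℓ]; exact Nat.zero_le _

/-- The `2`-part input (landed, Kenku level `32`, Mazur-free). -/
example {V V' : WeierstrassCurve ℚ} [V.IsElliptic] [V'.IsElliptic] (ψ : Isogeny V V')
    (hψ : ψ.IsCyclic) : ψ.degree ≠ 32 :=
  Summit.ABC.ABC.Theorems.isogeny_isCyclic_degree_ne_thirtyTwo ψ hψ

/-- **C0² (S assembly).**  Odd part: for each odd `ℓ ∣ deg` with `ℓᵏ ‖ deg`, G0 gives a stable line of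
order `ℓᵏ`; `W₁` is semistable above `ℓ` (`ℓ ≠ 2`); H5⁻ at a `pᵢ ≠ ℓ` (at least one of `p₀ ≠ p₁` is
`≠ ℓ`, and if both are, both apply) gives `ℓ^⌈k/2⌉ ∣ n₁₂(pᵢ)`, so `ℓᵏ ∣ (n₁₂(p₀) n₁₂(p₁))²` (C1);
`2`-part: `32 ∤` cyclic degrees (`isogeny_isCyclic_degree_ne_thirtyTwo` + `exists_isCyclic_degree_eq_of_dvd`),
so it divides `16`. -/
theorem cyclicDegreeDvdFrobNormSq : CyclicDegreeDvdFrobNormSq := by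
  sorry

/-- Chebyshev (tree, by name): a prime `p ∤ N` with `p ≤ 2 log N + C`. -/
example : ∃ C : ℝ, ∀ N : ℕ, N ≠ 0 → ∃ ℓ : ℕ, ℓ.Prime ∧ ¬ ℓ ∣ N ∧ (ℓ : ℝ) ≤ 2 * Real.log N + C :=
  exists_prime_not_dvd_le_log

/-- Semistability of the Frey curve away from `2` (tree, by name) — the ONLY semistability the line uses
(at `v = ℓ`, `ℓ` odd), transported to the Néron model by `isSemistableAt_smul_iff_holds`. -/
example (a b : ℤ) : isSemistableAt_freyCurve a b := isSemistableAt_freyCurve_holds a b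

/-- **SUB (S, the counting end; g6 B1 + B2 rooted).**  C0² ⟹ the rooted leaf: Néron model `C • E_(a,b)`
(`hasGlobalMinimalModel_rat_holds`; degree-`1` isogeny `VariableChange.toIsogeny`), semistable away from `2`
(`isSemistableAt_freyCurve_holds`, `isSemistableAt_smul_iff_holds`, places of `ℤ` ↔ `𝓞 ℚ`), a CYCLIC
isogeny `C • E → W'` (`IsIsogenous.exists_isCyclic`), two odd primes `p₀ ≠ p₁ ∤ N`, `pᵢ ≤ 2 log(2Np₀) + C`
(`exists_prime_not_dvd_le_log` at `2N` and `2Np₀`), good there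
(`radical_natAbs_dvd_two_mul_conductorNorm_freyCurve`, `hasGoodReductionAtPrime_of_not_dvd_conductorNorm`),
C0², Hasse `0 < n₁₂(p) ≤ (p⁶+1)²` (g6 H7/H7′ from `frobeniusTrace_sq_le_four_mul`,
`norm_frobTracePow_le_of_sq_le` (complex `frobTracePow`, g6 H7a bridges to `Mazur1978.frobTracePow`)), `Nat.le_of_dvd`, `degree_comp`, `(log N)⁴⁸ ≤ R_ε N^ε`. -/
theorem freyIsogenyRadiusSubpoly_of_sq (h0 : CyclicDegreeDvdFrobNormSq) : FreyIsogenyRadiusSubpoly := by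
  sorry

/-! ## §6 In-kernel sanity (quick refuters run)
* `halfCeil`: `k = 1` is Mazur's exact prime-level dichotomy, `k = 2` the sharp `11a3 → 11a2` loss.
* `11a1`, `p = 3`, `a₃ = −1`: `n₁₂(3) = 532800 = 2⁶·3²·5²·37`; the cyclic `25`-isogeny `11a3 → 11a2`
  needs `5^⌈2/2⌉ = 5 ∣ n₁₂(3)` ✓ (and `25 ∣ 16·n₁₂(3)²` ✓).
* T1⁺'s place split: no place contains both `2` and `3` (`3 − 2 = 1`). -/
example : halfCeil 1 = 1 ∧ halfCeil 2 = 1 ∧ halfCeil 3 = 2 ∧ halfCeil 4 = 2 := by decide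
example : Mazur1978.frobTracePow (-1) 3 12 = -1358 := by decide
example : (3 : ℤ) ^ 12 + 1 - (-1358) = 532800 ∧ (5 : ℤ) ∣ 532800 ∧ (25 : ℤ) ∣ 16 * 532800 ^ 2 := by
  decide

end Summit.ABC.ABC.Cruxes.DefiniteRTControlPrime.StubIdeas2G9
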